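import Mathlib
import Summits.ValiantsHypothesis.ValiantsHypothesis.Theorems.LacunarySymmetroidMatrixDescartesInertiaKit
import Summits.ValiantsHypothesis.ValiantsHypothesis.Theorems.LacunarySymmetroidMatrixDescartesInertiaEndInertias

/-!
# `MatrixDescartes` (stmt-ValiantsHypothesis-18050) — Gram duality, part 6: the dual pivot has at most the
# INERTIA of the base letter and rank at most the size (Sylvester's law for rectangular congruence)

HONEST FRAMING.  Cell `pub-symmetroid`, seat `val-sym-mdr-p2` (gen 19); helper file `--supports` the crux
`Theses.LacunarySymmetroid.MatrixDescartes` (OPEN), NO closure claim; companion of the Gram-duality files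
`…GramDual*` (a word `X^e B + U diag(σX^δ) Uᵀ` with non-degenerate base letter `B` has the positive zeros of the
dual word `diag(σ⁻¹X^{E−δ}) + X^{E−e}·UᵀB⁻¹U`).  General linear algebra in the inertia currency of `…InertiaKit`
(`ν(A) = card {j // hA.eigenvalues j < 0}`, `π(A) = card {j // 0 < hA.eigenvalues j}`); nothing here bears on the
crux in its window, `stub_twoSided`, `DoorA26` / `DoorA34`, registers, or `VP ≠ VNP`.

* `negIndex_conj_le` / `posIndex_conj_le` — **rectangular Sylvester**: for real symmetric `A : ι × ι` and ANY real
  `W : ι × ρ`, `ν(WᵀAW) ≤ ν(A)` and `π(WᵀAW) ≤ π(A)` (a negative eigenfamily of `WᵀAW` pushes forward under `W` to a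
  negative family of `A`; tree `Inertia.card_le_negIndex`).
* `negIndex_inv_eq` / `posIndex_inv_eq` — `ν(B⁻¹) = ν(B)`, `π(B⁻¹) = π(B)` for symmetric non-degenerate `B`
  (`B⁻¹ = B⁻¹ᵀ B B⁻¹`, `B = Bᵀ B⁻¹ B`).
* **`negIndex_gram_le` / `posIndex_gram_le` / `rank_gram_le` — THE DUAL PIVOT**: `ν(UᵀB⁻¹U) ≤ ν(B)`,
  `π(UᵀB⁻¹U) ≤ π(B)`, `rank(UᵀB⁻¹U) ≤ card ι`.  READING (with `…GramDual`): a two-sided word of size `m` whose pivot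
  has inertia `(p, q)` is root-equivalent to a word with DIAGONAL (coordinate-projector) letters whose pivot has
  inertia `≤ (p, q)` and rank `≤ m`; in particular index-one words dualise to index-`≤ 1` projector words, and
  NSD-pivot words to NSD-pivot projector words (`GramDual.gram_nonpos_of_pivot_nonpos`).

[folklore] (Sylvester's law of inertia).  Axioms `propext`, `Classical.choice`, `Quot.sound`.
-/

-- layout Summits/ValiantsHypothesis/ValiantsHypothesis forces the duplicated namespace component
set_option linter.dupNamespace false

namespace Summit.ValiantsHypothesis.ValiantsHypothesis.Theorems.LacunarySymmetroidMatrixDescartes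

open Matrix Finset
open scoped BigOperators

namespace GramDual

variable {ι ρ : Type} [Fintype ι] [DecidableEq ι] [Fintype ρ] [DecidableEq ρ]

omit [DecidableEq ι] [DecidableEq ρ] in
/-- The congruent form: `(W x)ᵀ A (W x) = xᵀ (WᵀAW) x`. [folklore] -/
theorem form_conj (A : Matrix ι ι ℝ) (W : Matrix ι ρ ℝ) (x : ρ → ℝ) :
    (W *ᵥ x) ⬝ᵥ (A *ᵥ (W *ᵥ x)) = x ⬝ᵥ ((Wᵀ * A * W) *ᵥ x) := by
  rw [← Matrix.mulVec_mulVec, ← Matrix.mulVec_mulVec, Matrix.dotProduct_mulVec x Wᵀ, Matrix.vecMul_transpose]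

omit [DecidableEq ι] [Fintype ρ] [DecidableEq ρ] in
/-- `WᵀAW` is symmetric when `A` is. [folklore] -/
theorem isSymm_conj {A : Matrix ι ι ℝ} (hA : A.IsSymm) (W : Matrix ι ρ ℝ) : (Wᵀ * A * W).IsSymm := by
  unfold Matrix.IsSymm
  rw [Matrix.transpose_mul, Matrix.transpose_mul, Matrix.transpose_transpose, hA.eq, Matrix.mul_assoc]

omit [Fintype ι] [DecidableEq ι] [DecidableEq ρ] in
/-- Push-forward of a combination: `W (∑ cᵢ bᵢ) = ∑ cᵢ (W bᵢ)`. [folklore] -/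
theorem mulVec_sum_smul {α : Type} [Fintype α] (W : Matrix ι ρ ℝ) (c : α → ℝ) (b : α → ρ → ℝ) :
    W *ᵥ (∑ i, c i • b i) = ∑ i, c i • (W *ᵥ b i) := by
  rw [Matrix.mulVec_sum]
  refine Finset.sum_congr rfl fun i _ => ?_
  rw [Matrix.mulVec_smul]

/-- **Rectangular Sylvester, negative index**: `ν(WᵀAW) ≤ ν(A)` for real symmetric `A` and any real `W : ι × ρ`.
[folklore] -/
theorem negIndex_conj_le {A : Matrix ι ι ℝ} (hA : A.IsHermitian) (W : Matrix ι ρ ℝ)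
    (hC : (Wᵀ * A * W).IsHermitian) :
    Fintype.card {j // hC.eigenvalues j < 0} ≤ Fintype.card {j // hA.eigenvalues j < 0} := by
  classical
  refine Inertia.card_le_negIndex hA (fun i : {j // hC.eigenvalues j < 0} => W *ᵥ (hC.eigenvectorBasis i.1).ofLp)
    fun c hc => ?_
  rw [← mulVec_sum_smul, form_conj]
  exact Inertia.neg_eigenFamily hC c hc

/-- **Rectangular Sylvester, positive index**: `π(WᵀAW) ≤ π(A)`. [folklore] -/
theorem posIndex_conj_le {A : Matrix ι ι ℝ} (hA : A.IsHermitian) (W : Matrix ι ρ ℝ)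
    (hC : (Wᵀ * A * W).IsHermitian) :
    Fintype.card {j // 0 < hC.eigenvalues j} ≤ Fintype.card {j // 0 < hA.eigenvalues j} := by
  classical
  refine Inertia.card_le_posIndex hA (fun i : {j // 0 < hC.eigenvalues j} => W *ᵥ (hC.eigenvectorBasis i.1).ofLp)
    fun c hc => ?_
  rw [← mulVec_sum_smul, form_conj]
  exact Inertia.pos_eigenFamily hC c hc

omit [Fintype ρ] [DecidableEq ρ] in
/-- `B⁻¹` is symmetric when `B` is. [folklore] -/
theorem isSymm_inv {B : Matrix ι ι ℝ} (hB : B.IsSymm) : B⁻¹.IsSymm := by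
  unfold Matrix.IsSymm
  rw [Matrix.transpose_nonsing_inv, hB.eq]

omit [Fintype ρ] [DecidableEq ρ] in
/-- `B⁻¹ = (B⁻¹)ᵀ · B · B⁻¹` for symmetric non-degenerate `B`. [folklore] -/
theorem inv_eq_conj {B : Matrix ι ι ℝ} (hB : B.IsSymm) (hBu : IsUnit B.det) : B⁻¹ = (B⁻¹)ᵀ * B * B⁻¹ := by
  rw [(isSymm_inv hB).eq, Matrix.nonsing_inv_mul _ hBu, Matrix.one_mul]

omit [Fintype ρ] [DecidableEq ρ] in
/-- `B = Bᵀ · B⁻¹ · B` for symmetric non-degenerate `B`. [folklore] -/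
theorem self_eq_conj_inv {B : Matrix ι ι ℝ} (hB : B.IsSymm) (hBu : IsUnit B.det) : B = Bᵀ * B⁻¹ * B := by
  rw [hB.eq, Matrix.mul_nonsing_inv _ hBu, Matrix.one_mul]

omit [Fintype ρ] [DecidableEq ρ] in
/-- **`ν(B⁻¹) = ν(B)`** for symmetric non-degenerate `B`. [folklore] -/
theorem negIndex_inv_eq {B : Matrix ι ι ℝ} (hBs : B.IsSymm) (hBu : IsUnit B.det) (hB : B.IsHermitian)
    (hBi : B⁻¹.IsHermitian) :
    Fintype.card {j // hBi.eigenvalues j < 0} = Fintype.card {j // hB.eigenvalues j < 0} := by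
  apply le_antisymm
  · have hC : ((B⁻¹)ᵀ * B * B⁻¹).IsHermitian := by rw [← inv_eq_conj hBs hBu]; exact hBi
    calc Fintype.card {j // hBi.eigenvalues j < 0} = Fintype.card {j // hC.eigenvalues j < 0} :=
          Inertia.negIndex_congr hBi hC (inv_eq_conj hBs hBu)
      _ ≤ _ := negIndex_conj_le hB B⁻¹ hC
  · have hC : (Bᵀ * B⁻¹ * B).IsHermitian := by rw [← self_eq_conj_inv hBs hBu]; exact hB
    calc Fintype.card {j // hB.eigenvalues j < 0} = Fintype.card {j // hC.eigenvalues j < 0} :=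
          Inertia.negIndex_congr hB hC (self_eq_conj_inv hBs hBu)
      _ ≤ _ := negIndex_conj_le hBi B hC

omit [Fintype ρ] [DecidableEq ρ] in
/-- **`π(B⁻¹) = π(B)`** for symmetric non-degenerate `B`. [folklore] -/
theorem posIndex_inv_eq {B : Matrix ι ι ℝ} (hBs : B.IsSymm) (hBu : IsUnit B.det) (hB : B.IsHermitian)
    (hBi : B⁻¹.IsHermitian) :
    Fintype.card {j // 0 < hBi.eigenvalues j} = Fintype.card {j // 0 < hB.eigenvalues j} := by
  apply le_antisymm
  · have hC : ((B⁻¹)ᵀ * B * B⁻¹).IsHermitian := by rw [← inv_eq_conj hBs hBu]; exact hBi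
    calc Fintype.card {j // 0 < hBi.eigenvalues j} = Fintype.card {j // 0 < hC.eigenvalues j} :=
          Inertia.posIndex_congr hBi hC (inv_eq_conj hBs hBu)
      _ ≤ _ := posIndex_conj_le hB B⁻¹ hC
  · have hC : (Bᵀ * B⁻¹ * B).IsHermitian := by rw [← self_eq_conj_inv hBs hBu]; exact hB
    calc Fintype.card {j // 0 < hB.eigenvalues j} = Fintype.card {j // 0 < hC.eigenvalues j} :=
          Inertia.posIndex_congr hB hC (self_eq_conj_inv hBs hBu)
      _ ≤ _ := posIndex_conj_le hBi B hC

/-- **THE DUAL PIVOT HAS AT MOST THE NEGATIVE INDEX OF THE BASE**: `ν(UᵀB⁻¹U) ≤ ν(B)` for symmetric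
non-degenerate `B` and any real `U : ι × ρ`. [folklore] -/
theorem negIndex_gram_le {B : Matrix ι ι ℝ} (hBs : B.IsSymm) (hBu : IsUnit B.det) (hB : B.IsHermitian)
    (U : Matrix ι ρ ℝ) (hC : (Uᵀ * B⁻¹ * U).IsHermitian) :
    Fintype.card {j // hC.eigenvalues j < 0} ≤ Fintype.card {j // hB.eigenvalues j < 0} := by
  have hBi : B⁻¹.IsHermitian := Inertia.isHermitian_of_isSymm (isSymm_inv hBs)
  rw [← negIndex_inv_eq hBs hBu hB hBi]
  exact negIndex_conj_le hBi U hC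

/-- **THE DUAL PIVOT HAS AT MOST THE POSITIVE INDEX OF THE BASE**: `π(UᵀB⁻¹U) ≤ π(B)`. [folklore] -/
theorem posIndex_gram_le {B : Matrix ι ι ℝ} (hBs : B.IsSymm) (hBu : IsUnit B.det) (hB : B.IsHermitian)
    (U : Matrix ι ρ ℝ) (hC : (Uᵀ * B⁻¹ * U).IsHermitian) :
    Fintype.card {j // 0 < hC.eigenvalues j} ≤ Fintype.card {j // 0 < hB.eigenvalues j} := by
  have hBi : B⁻¹.IsHermitian := Inertia.isHermitian_of_isSymm (isSymm_inv hBs)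
  rw [← posIndex_inv_eq hBs hBu hB hBi]
  exact posIndex_conj_le hBi U hC

omit [DecidableEq ρ] in
/-- **THE DUAL PIVOT HAS RANK AT MOST THE SIZE OF THE BASE**: `rank(UᵀB⁻¹U) ≤ card ι`. [folklore] -/
theorem rank_gram_le (B : Matrix ι ι ℝ) (U : Matrix ι ρ ℝ) : (Uᵀ * B⁻¹ * U).rank ≤ Fintype.card ι :=
  (Matrix.rank_mul_le_right _ _).trans (Matrix.rank_le_card_height U)

omit [Fintype ρ] [DecidableEq ρ] in
/-- The dual pivot is symmetric for a symmetric base (so the index statements apply). [folklore] -/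
theorem isHermitian_gram {B : Matrix ι ι ℝ} (hBs : B.IsSymm) (U : Matrix ι ρ ℝ) : (Uᵀ * B⁻¹ * U).IsHermitian :=
  Inertia.isHermitian_of_isSymm (isSymm_conj (isSymm_inv hBs) U)

end GramDual

end Summit.ValiantsHypothesis.ValiantsHypothesis.Theorems.LacunarySymmetroidMatrixDescartes
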